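import Mathlib
import Summits.ResolutionOfSingularities.ResolutionOfSingularities.Theorems.HomologicalConductorPersistenceArenaLowerMiddle
import HarnessLib

/-!
# Crux `Persistence` (stmt-ResolutionOfSingularities-16484) / rung S-2 cA ARENA — the ENABLING FORMULA's lower half,
# FACT-FREE for every `h`: `(x, y) + ca²(k[z,t]/(h))·T_h ⊆ ca⁴(T_h)`, `T_h = k[x,y,z,t]/(xy − h)`

Route `ResolutionOfSingularities/HomologicalConductor`, chain W4.4b (cell `res-hironaka`): crux `Persistence`
(stmt-ResolutionOfSingularities-16484, K-C3 family of kill sources) and rung S-2 `PersistenceSurface` (stmt-…-19970, the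
«cA ARENA» `T_h = {xy = h(z,t)}` of res-L1-w44b-plan-1's K-v13 (c), whose ENABLING FORMULA `ca(T_h) = (x,y) + ca(C_h)·T_h`
was admitted from print as THEOREM DP).  `[OURS · L1 w44b · res-L1-w44b-stub-2 gen 4]`; NOT a statement of the manuscript
under review (Hironaka 2017), no statement of that manuscript is used; AI-written, weaker than expert review.

## Statement (`mk_inclusion_mem_cohomologyAnnihilatorOfDegree_four`)

`k` a field with `2 ≠ 0`, `0 ≠ h ∈ k[z,t] = MvPolynomial (Fin 2) k`, `ι : k[z,t] → k[x,y,z,t]` (`z ↦ X 2`, `t ↦ X 3`),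
`T_h = k[x,y,z,t]/(xy − ι h)`, `C_h = k[z,t]/(h)`.  If `c̄ ∈ ca²(C_h)` then `(ι c)‾ ∈ ca⁴(T_h)`; also `x̄, ȳ ∈ ca⁴(T_h)`.
Hence `((x, y) + ι(ca²(C_h)))·T_h ≤ ca⁴(T_h) ≤ ca(T_h)` (`map_le_cohomologyAnnihilatorOfDegree_four`), and the same at every
localisation of `T_h`.  NO hypothesis on `h` beyond `h ≠ 0` (reduced / unibranch / isolated not needed); the curve-level
input `ca²(C_h)` is whatever one knows (conductor of a parametrised branch via `…PersistenceConductorStable`, Jacobian, …).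

## Proof (= the K-C3 tower of `…PersistenceKC3Lower` with `h` a variable)

`T_h ↠(y ↦ x) B_h = k[x,z,t]/(x² − h) ↠(x ↦ 0) C_h`, kernels `(x̄ − ȳ)` and `(x̄)`; `x̄ − ȳ ∈ T_h⁰ ∩ ca⁴(T_h)`
(`x = ∂f/∂y`, `y = ∂f/∂x`), `x̄ ∈ B_h⁰ ∩ ca³(B_h)` (`2x = ∂F′/∂x`); quotient ascent along surjections
(`KC3Lower.mem_cohomologyAnnihilatorOfDegree_of_surjective`, p535893, from `QuotientAscent` p531707) twice.

References (mechanism only): res-L1-w44b-plan-1 CHAIN w44b v13.3–13.9 (K-v13 (c) arena, THEOREM DP); Ö. Esentepe, J. Algebra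
541 (2020) Thm 5.4 (whose lower-bound half this proves for the xy-form, all characteristics ≠ 2) [`Esentepe2020`]; H. Knörrer,
Invent. Math. 88 (1987).
-/

noncomputable section

-- single-problem summit: the doubled namespace component `ResolutionOfSingularities` is forced
set_option linter.dupNamespace false

namespace Summit.ResolutionOfSingularities.ResolutionOfSingularities.Theorems.HomologicalConductor.ArenaLower

open MvPolynomial Literature.RingTheory.CohomologyAnnihilator
open Summit.ResolutionOfSingularities.ResolutionOfSingularities.Theorems.HomologicalConductor.PersistenceJacobianKept
open Summit.ResolutionOfSingularities.ResolutionOfSingularities.Theorems.HomologicalConductor.QuotientAscent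
open Summit.ResolutionOfSingularities.ResolutionOfSingularities.Theorems.HomologicalConductor.KC3Lower
open Summit.ResolutionOfSingularities.ResolutionOfSingularities.Theorems.HomologicalConductor.ArenaLowerMiddle
open scoped nonZeroDivisors

universe u

variable (k : Type u) [Field k]
/-! ## §3 The first stage `T_h = k[x,y,z,t]/(xy − h) ↠ B_h` -/

/-- `x̄ − ȳ ∈ T_h⁰` (`f ≡ F′ ≠ 0 mod x − y`). [folklore] -/
theorem mk_X0_sub_X1_mem_nonZeroDivisors_general (h2 : (2 : k) ≠ 0) (h : MvPolynomial (Fin 2) k) :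
    Ideal.Quotient.mk (Ideal.span ({X 0 * X 1 - (MvPolynomial.aeval (![X 2, X 3] : Fin 2 → MvPolynomial (Fin 4) k)) h} :
        Set (MvPolynomial (Fin 4) k))) (X 0 - X 1) ∈
      (MvPolynomial (Fin 4) k ⧸ Ideal.span ({X 0 * X 1 - (MvPolynomial.aeval (![X 2, X 3] :
        Fin 2 → MvPolynomial (Fin 4) k)) h} : Set (MvPolynomial (Fin 4) k)))⁰ := by
  refine mk_mem_nonZeroDivisors_of_ringHom
    (MvPolynomial.aeval (![X 0, X 0, X 1, X 2] : Fin 4 → MvPolynomial (Fin 3) k)).toRingHom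
    (mem_nonZeroDivisors_of_ne_zero ?_) (by simp) (fun q hq => ?_) ?_
  · intro h0
    have h' := congrArg (MvPolynomial.eval (![1, 0, 0, 0] : Fin 4 → k)) h0
    simp at h'
  · have hq' := sub_inclusion_sigma_mem k q
    rw [AlgHom.toRingHom_eq_coe, RingHom.coe_coe] at hq
    rw [hq, map_zero, sub_zero] at hq'
    exact Ideal.mem_span_singleton.mp hq'
  · rw [AlgHom.toRingHom_eq_coe, RingHom.coe_coe, sigma_f_general]
    exact mem_nonZeroDivisors_of_ne_zero (F'_general_ne_zero k h2 h)

/-- `x̄ ∈ ca⁴(T_h)` (`x = ∂f/∂y`). [folklore] -/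
theorem mk_X0_mem_cohomologyAnnihilatorOfDegree_four_general (h : MvPolynomial (Fin 2) k) :
    Ideal.Quotient.mk (Ideal.span ({X 0 * X 1 - (MvPolynomial.aeval (![X 2, X 3] : Fin 2 → MvPolynomial (Fin 4) k)) h} :
        Set (MvPolynomial (Fin 4) k))) (X 0) ∈
      cohomologyAnnihilatorOfDegree (MvPolynomial (Fin 4) k ⧸ Ideal.span ({X 0 * X 1 -
        (MvPolynomial.aeval (![X 2, X 3] : Fin 2 → MvPolynomial (Fin 4) k)) h} : Set (MvPolynomial (Fin 4) k))) 4 := by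
  have hd : Ideal.Quotient.mk (Ideal.span ({X 0 * X 1 - (MvPolynomial.aeval (![X 2, X 3] :
        Fin 2 → MvPolynomial (Fin 4) k)) h} : Set (MvPolynomial (Fin 4) k))) (MvPolynomial.pderiv 1
        (X 0 * X 1 - (MvPolynomial.aeval (![X 2, X 3] : Fin 2 → MvPolynomial (Fin 4) k)) h)) ∈
      cohomologyAnnihilatorOfDegree (MvPolynomial (Fin 4) k ⧸ Ideal.span ({X 0 * X 1 -
        (MvPolynomial.aeval (![X 2, X 3] : Fin 2 → MvPolynomial (Fin 4) k)) h} : Set (MvPolynomial (Fin 4) k))) 4 :=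
    pderiv_mem_cohomologyAnnihilatorOfDegree (d := 3) _ (f_general_ne_zero k h) 1
  rwa [pderiv_one_f_general] at hd

/-- `ȳ ∈ ca⁴(T_h)` (`y = ∂f/∂x`). [folklore] -/
theorem mk_X1_mem_cohomologyAnnihilatorOfDegree_four_general (h : MvPolynomial (Fin 2) k) :
    Ideal.Quotient.mk (Ideal.span ({X 0 * X 1 - (MvPolynomial.aeval (![X 2, X 3] : Fin 2 → MvPolynomial (Fin 4) k)) h} :
        Set (MvPolynomial (Fin 4) k))) (X 1) ∈
      cohomologyAnnihilatorOfDegree (MvPolynomial (Fin 4) k ⧸ Ideal.span ({X 0 * X 1 -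
        (MvPolynomial.aeval (![X 2, X 3] : Fin 2 → MvPolynomial (Fin 4) k)) h} : Set (MvPolynomial (Fin 4) k))) 4 := by
  have hd : Ideal.Quotient.mk (Ideal.span ({X 0 * X 1 - (MvPolynomial.aeval (![X 2, X 3] :
        Fin 2 → MvPolynomial (Fin 4) k)) h} : Set (MvPolynomial (Fin 4) k))) (MvPolynomial.pderiv 0
        (X 0 * X 1 - (MvPolynomial.aeval (![X 2, X 3] : Fin 2 → MvPolynomial (Fin 4) k)) h)) ∈
      cohomologyAnnihilatorOfDegree (MvPolynomial (Fin 4) k ⧸ Ideal.span ({X 0 * X 1 -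
        (MvPolynomial.aeval (![X 2, X 3] : Fin 2 → MvPolynomial (Fin 4) k)) h} : Set (MvPolynomial (Fin 4) k))) 4 :=
    pderiv_mem_cohomologyAnnihilatorOfDegree (d := 3) _ (f_general_ne_zero k h) 0
  rwa [pderiv_zero_f_general] at hd

/-- `x̄ − ȳ ∈ ca⁴(T_h)`. [folklore] -/
theorem mk_X0_sub_X1_mem_cohomologyAnnihilatorOfDegree_four_general (h : MvPolynomial (Fin 2) k) :
    Ideal.Quotient.mk (Ideal.span ({X 0 * X 1 - (MvPolynomial.aeval (![X 2, X 3] : Fin 2 → MvPolynomial (Fin 4) k)) h} :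
        Set (MvPolynomial (Fin 4) k))) (X 0 - X 1) ∈
      cohomologyAnnihilatorOfDegree (MvPolynomial (Fin 4) k ⧸ Ideal.span ({X 0 * X 1 -
        (MvPolynomial.aeval (![X 2, X 3] : Fin 2 → MvPolynomial (Fin 4) k)) h} : Set (MvPolynomial (Fin 4) k))) 4 := by
  rw [map_sub]
  exact Ideal.sub_mem _ (mk_X0_mem_cohomologyAnnihilatorOfDegree_four_general k h)
    (mk_X1_mem_cohomologyAnnihilatorOfDegree_four_general k h)

/-- **`T_h ↠ B_h`**: `σ : y ↦ x` induces a SURJECTIVE ring map `k[x,y,z,t]/(xy − h) → k[x,z,t]/(x² − h)` with kernel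
`(x̄ − ȳ)`, values `(σ g)‾`. [OURS · L1 w44b] -/
theorem exists_ringHom_middleStage_general (h : MvPolynomial (Fin 2) k) :
    ∃ Ψ : (MvPolynomial (Fin 4) k ⧸ Ideal.span ({X 0 * X 1 - (MvPolynomial.aeval (![X 2, X 3] :
        Fin 2 → MvPolynomial (Fin 4) k)) h} : Set (MvPolynomial (Fin 4) k))) →+*
        (MvPolynomial (Fin 3) k ⧸ Ideal.span ({X 0 ^ 2 - (MvPolynomial.aeval (![X 1, X 2] :
          Fin 2 → MvPolynomial (Fin 3) k)) h} : Set (MvPolynomial (Fin 3) k))),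
      Function.Surjective Ψ ∧ RingHom.ker Ψ = Ideal.span {Ideal.Quotient.mk _ (X 0 - X 1)} ∧
      ∀ g : MvPolynomial (Fin 4) k, Ψ (Ideal.Quotient.mk _ g) =
        Ideal.Quotient.mk _ ((MvPolynomial.aeval (![X 0, X 0, X 1, X 2] : Fin 4 → MvPolynomial (Fin 3) k)) g) := by
  set Ψ₀ : MvPolynomial (Fin 4) k →+* (MvPolynomial (Fin 3) k ⧸ Ideal.span ({X 0 ^ 2 - (MvPolynomial.aeval (![X 1, X 2] :
      Fin 2 → MvPolynomial (Fin 3) k)) h} : Set (MvPolynomial (Fin 3) k))) :=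
    (Ideal.Quotient.mk _).comp
      (MvPolynomial.aeval (![X 0, X 0, X 1, X 2] : Fin 4 → MvPolynomial (Fin 3) k)).toRingHom with hΨ₀
  have hΨ₀_apply : ∀ g, Ψ₀ g =
      Ideal.Quotient.mk _ ((MvPolynomial.aeval (![X 0, X 0, X 1, X 2] : Fin 4 → MvPolynomial (Fin 3) k)) g) :=
    fun g => rfl
  have hΨ₀f : ∀ a ∈ Ideal.span ({X 0 * X 1 - (MvPolynomial.aeval (![X 2, X 3] : Fin 2 → MvPolynomial (Fin 4) k)) h} :
      Set (MvPolynomial (Fin 4) k)), Ψ₀ a = 0 := by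
    intro a ha
    obtain ⟨v, rfl⟩ := Ideal.mem_span_singleton'.mp ha
    rw [map_mul, hΨ₀_apply (X 0 * X 1 - _), sigma_f_general,
      Ideal.Quotient.eq_zero_iff_mem.mpr (Ideal.mem_span_singleton_self _), mul_zero]
  set Ψ := Ideal.Quotient.lift _ Ψ₀ hΨ₀f with hΨ
  have hΨ_mk : ∀ g, Ψ (Ideal.Quotient.mk _ g) = Ψ₀ g := fun g => Ideal.Quotient.lift_mk _ _ _
  refine ⟨Ψ, ?_, ?_, fun g => by rw [hΨ_mk, hΨ₀_apply]⟩
  · intro u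
    obtain ⟨g, rfl⟩ := Ideal.Quotient.mk_surjective u
    exact ⟨Ideal.Quotient.mk _ ((MvPolynomial.aeval (![X 0, X 2, X 3] : Fin 3 → MvPolynomial (Fin 4) k)) g),
      by rw [hΨ_mk, hΨ₀_apply, sigma_comp_inclusion]⟩
  · apply le_antisymm
    · intro u hu
      obtain ⟨g, rfl⟩ := Ideal.Quotient.mk_surjective u
      rw [RingHom.mem_ker, hΨ_mk, hΨ₀_apply, Ideal.Quotient.eq_zero_iff_mem, Ideal.mem_span_singleton'] at hu
      obtain ⟨r, hr⟩ := hu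
      have hmem : g - (MvPolynomial.aeval (![X 0, X 2, X 3] : Fin 3 → MvPolynomial (Fin 4) k)) r *
          (X 0 * X 1 - (MvPolynomial.aeval (![X 2, X 3] : Fin 2 → MvPolynomial (Fin 4) k)) h) ∈
          Ideal.span ({X 0 - X 1} : Set (MvPolynomial (Fin 4) k)) := by
        have h1 := sub_inclusion_sigma_mem k g
        rw [← hr, map_mul, inclusion_F'_general] at h1
        have hid : g - (MvPolynomial.aeval (![X 0, X 2, X 3] : Fin 3 → MvPolynomial (Fin 4) k)) r *
            (X 0 * X 1 - (MvPolynomial.aeval (![X 2, X 3] : Fin 2 → MvPolynomial (Fin 4) k)) h) =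
            (g - (MvPolynomial.aeval (![X 0, X 2, X 3] : Fin 3 → MvPolynomial (Fin 4) k)) r *
              ((X 0 * X 1 - (MvPolynomial.aeval (![X 2, X 3] : Fin 2 → MvPolynomial (Fin 4) k)) h) +
                X 0 * (X 0 - X 1))) +
            (MvPolynomial.aeval (![X 0, X 2, X 3] : Fin 3 → MvPolynomial (Fin 4) k)) r * X 0 * (X 0 - X 1) := by
          ring
        rw [hid]
        exact Ideal.add_mem _ h1 (Ideal.mul_mem_left _ _ (Ideal.mem_span_singleton_self _))
      have heq : Ideal.Quotient.mk (Ideal.span ({X 0 * X 1 - (MvPolynomial.aeval (![X 2, X 3] :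
            Fin 2 → MvPolynomial (Fin 4) k)) h} : Set (MvPolynomial (Fin 4) k))) g =
          Ideal.Quotient.mk _ (g - (MvPolynomial.aeval (![X 0, X 2, X 3] : Fin 3 → MvPolynomial (Fin 4) k)) r *
            (X 0 * X 1 - (MvPolynomial.aeval (![X 2, X 3] : Fin 2 → MvPolynomial (Fin 4) k)) h)) := by
        rw [Ideal.Quotient.eq]
        have : g - (g - (MvPolynomial.aeval (![X 0, X 2, X 3] : Fin 3 → MvPolynomial (Fin 4) k)) r *
            (X 0 * X 1 - (MvPolynomial.aeval (![X 2, X 3] : Fin 2 → MvPolynomial (Fin 4) k)) h)) =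
            (MvPolynomial.aeval (![X 0, X 2, X 3] : Fin 3 → MvPolynomial (Fin 4) k)) r *
              (X 0 * X 1 - (MvPolynomial.aeval (![X 2, X 3] : Fin 2 → MvPolynomial (Fin 4) k)) h) := by ring
        rw [this]
        exact Ideal.mul_mem_left _ _ (Ideal.mem_span_singleton_self _)
      have hmap : (Ideal.span ({X 0 - X 1} : Set (MvPolynomial (Fin 4) k))).map
          (Ideal.Quotient.mk (Ideal.span ({X 0 * X 1 - (MvPolynomial.aeval (![X 2, X 3] :
            Fin 2 → MvPolynomial (Fin 4) k)) h} : Set (MvPolynomial (Fin 4) k)))) =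
          Ideal.span {Ideal.Quotient.mk (Ideal.span ({X 0 * X 1 - (MvPolynomial.aeval (![X 2, X 3] :
            Fin 2 → MvPolynomial (Fin 4) k)) h} : Set (MvPolynomial (Fin 4) k))) (X 0 - X 1)} := by
        rw [Ideal.map_span, Set.image_singleton]
      rw [heq, ← hmap]
      exact Ideal.mem_map_of_mem _ hmem
    · rw [Ideal.span_le, Set.singleton_subset_iff, SetLike.mem_coe, RingHom.mem_ker, hΨ_mk, hΨ₀_apply]
      have h0 : (MvPolynomial.aeval (![X 0, X 0, X 1, X 2] : Fin 4 → MvPolynomial (Fin 3) k))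
          (X 0 - X 1 : MvPolynomial (Fin 4) k) = 0 := by simp
      rw [h0, map_zero]

/-! ## §4 The arena lower bound -/

/-- **ARENA LOWER BOUND (OURS · L1 w44b), fact-free, every `h`**: for a field `k` with `2 ≠ 0`, `0 ≠ h ∈ k[z,t]` and
`c ∈ k[z,t]` with `c̄ ∈ ca²(k[z,t]/(h))`: `(ι c)‾ ∈ ca⁴(k[x,y,z,t]/(xy − ι h))`, `ι : z ↦ X 2, t ↦ X 3`. -/
theorem mk_inclusion_mem_cohomologyAnnihilatorOfDegree_four (h2 : (2 : k) ≠ 0) (h : MvPolynomial (Fin 2) k) (hh : h ≠ 0)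
    (c : MvPolynomial (Fin 2) k)
    (hc : Ideal.Quotient.mk (Ideal.span ({h} : Set (MvPolynomial (Fin 2) k))) c ∈
      cohomologyAnnihilatorOfDegree (MvPolynomial (Fin 2) k ⧸ Ideal.span ({h} : Set (MvPolynomial (Fin 2) k))) 2) :
    Ideal.Quotient.mk (Ideal.span ({X 0 * X 1 - (MvPolynomial.aeval (![X 2, X 3] : Fin 2 → MvPolynomial (Fin 4) k)) h} :
        Set (MvPolynomial (Fin 4) k))) ((MvPolynomial.aeval (![X 2, X 3] : Fin 2 → MvPolynomial (Fin 4) k)) c) ∈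
      cohomologyAnnihilatorOfDegree (MvPolynomial (Fin 4) k ⧸ Ideal.span ({X 0 * X 1 -
        (MvPolynomial.aeval (![X 2, X 3] : Fin 2 → MvPolynomial (Fin 4) k)) h} : Set (MvPolynomial (Fin 4) k))) 4 := by
  have hB := mk_inclusion₃_mem_cohomologyAnnihilatorOfDegree_three k h2 h hh c hc
  obtain ⟨Ψ, hsurj, hker, hΨ⟩ := exists_ringHom_middleStage_general k h
  refine mem_cohomologyAnnihilatorOfDegree_of_surjective Ψ hsurj hker (mk_X0_sub_X1_mem_nonZeroDivisors_general k h2 h)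
    (m := 2) (mk_X0_sub_X1_mem_cohomologyAnnihilatorOfDegree_four_general k h) ?_
  rw [hΨ, sigma_inclusion₄]
  exact hB

/-- **Ideal form**: `((x, y) + ι(ca²(C_h)))·T_h ≤ ca⁴(T_h)` — the preimage in `k[z,t]` of `ca²(k[z,t]/(h))`, pushed into
`k[x,y,z,t]` along `ι` and added to `(x, y)`, maps into `ca⁴(k[x,y,z,t]/(xy − ι h))`. [OURS · L1 w44b] -/
theorem map_le_cohomologyAnnihilatorOfDegree_four (h2 : (2 : k) ≠ 0) (h : MvPolynomial (Fin 2) k) (hh : h ≠ 0) :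
    (Ideal.span ({X 0, X 1} : Set (MvPolynomial (Fin 4) k)) ⊔
        ((cohomologyAnnihilatorOfDegree (MvPolynomial (Fin 2) k ⧸ Ideal.span ({h} : Set (MvPolynomial (Fin 2) k))) 2).comap
          (Ideal.Quotient.mk (Ideal.span ({h} : Set (MvPolynomial (Fin 2) k))))).map
          (MvPolynomial.aeval (![X 2, X 3] : Fin 2 → MvPolynomial (Fin 4) k)).toRingHom).map
        (Ideal.Quotient.mk (Ideal.span ({X 0 * X 1 - (MvPolynomial.aeval (![X 2, X 3] :
          Fin 2 → MvPolynomial (Fin 4) k)) h} : Set (MvPolynomial (Fin 4) k)))) ≤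
      cohomologyAnnihilatorOfDegree (MvPolynomial (Fin 4) k ⧸ Ideal.span ({X 0 * X 1 -
        (MvPolynomial.aeval (![X 2, X 3] : Fin 2 → MvPolynomial (Fin 4) k)) h} : Set (MvPolynomial (Fin 4) k))) 4 := by
  rw [Ideal.map_sup, sup_le_iff]
  constructor
  · rw [Ideal.map_span, Ideal.span_le]
    rintro _ ⟨g, hg, rfl⟩
    simp only [Set.mem_insert_iff, Set.mem_singleton_iff] at hg
    rcases hg with rfl | rfl
    · exact mk_X0_mem_cohomologyAnnihilatorOfDegree_four_general k h
    · exact mk_X1_mem_cohomologyAnnihilatorOfDegree_four_general k h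
  · rw [Ideal.map_map, Ideal.map_le_iff_le_comap]
    intro c hc
    rw [Ideal.mem_comap] at hc ⊢
    exact mk_inclusion_mem_cohomologyAnnihilatorOfDegree_four k h2 h hh c hc

/-- `ca`-form of the arena lower bound. [OURS · L1 w44b] -/
theorem map_le_cohomologyAnnihilator (h2 : (2 : k) ≠ 0) (h : MvPolynomial (Fin 2) k) (hh : h ≠ 0) :
    (Ideal.span ({X 0, X 1} : Set (MvPolynomial (Fin 4) k)) ⊔
        ((cohomologyAnnihilatorOfDegree (MvPolynomial (Fin 2) k ⧸ Ideal.span ({h} : Set (MvPolynomial (Fin 2) k))) 2).comap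
          (Ideal.Quotient.mk (Ideal.span ({h} : Set (MvPolynomial (Fin 2) k))))).map
          (MvPolynomial.aeval (![X 2, X 3] : Fin 2 → MvPolynomial (Fin 4) k)).toRingHom).map
        (Ideal.Quotient.mk (Ideal.span ({X 0 * X 1 - (MvPolynomial.aeval (![X 2, X 3] :
          Fin 2 → MvPolynomial (Fin 4) k)) h} : Set (MvPolynomial (Fin 4) k)))) ≤
      cohomologyAnnihilator (MvPolynomial (Fin 4) k ⧸ Ideal.span ({X 0 * X 1 -
        (MvPolynomial.aeval (![X 2, X 3] : Fin 2 → MvPolynomial (Fin 4) k)) h} : Set (MvPolynomial (Fin 4) k))) :=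
  (map_le_cohomologyAnnihilatorOfDegree_four k h2 h hh).trans (cohomologyAnnihilatorOfDegree_le 4)

/-- **Localised form**: at every localisation `T` of `T_h` (e.g. the local ring at the origin), the same ideal maps into
`ca⁴(T)`. [OURS · L1 w44b; cite: IyengarTakahashi2014, Lemma 2.10 (1)] -/
theorem map_map_le_cohomologyAnnihilatorOfDegree_four_of_isLocalization (h2 : (2 : k) ≠ 0) (h : MvPolynomial (Fin 2) k)
    (hh : h ≠ 0)
    (M : Submonoid (MvPolynomial (Fin 4) k ⧸ Ideal.span ({X 0 * X 1 - (MvPolynomial.aeval (![X 2, X 3] :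
      Fin 2 → MvPolynomial (Fin 4) k)) h} : Set (MvPolynomial (Fin 4) k))))
    (T : Type u) [CommRing T]
    [Algebra (MvPolynomial (Fin 4) k ⧸ Ideal.span ({X 0 * X 1 - (MvPolynomial.aeval (![X 2, X 3] :
      Fin 2 → MvPolynomial (Fin 4) k)) h} : Set (MvPolynomial (Fin 4) k))) T] [IsLocalization M T] :
    ((Ideal.span ({X 0, X 1} : Set (MvPolynomial (Fin 4) k)) ⊔
        ((cohomologyAnnihilatorOfDegree (MvPolynomial (Fin 2) k ⧸ Ideal.span ({h} : Set (MvPolynomial (Fin 2) k))) 2).comap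
          (Ideal.Quotient.mk (Ideal.span ({h} : Set (MvPolynomial (Fin 2) k))))).map
          (MvPolynomial.aeval (![X 2, X 3] : Fin 2 → MvPolynomial (Fin 4) k)).toRingHom).map
        (Ideal.Quotient.mk (Ideal.span ({X 0 * X 1 - (MvPolynomial.aeval (![X 2, X 3] :
          Fin 2 → MvPolynomial (Fin 4) k)) h} : Set (MvPolynomial (Fin 4) k))))).map
        (algebraMap (MvPolynomial (Fin 4) k ⧸ Ideal.span ({X 0 * X 1 - (MvPolynomial.aeval (![X 2, X 3] :
          Fin 2 → MvPolynomial (Fin 4) k)) h} : Set (MvPolynomial (Fin 4) k))) T) ≤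
      cohomologyAnnihilatorOfDegree T 4 :=
  (Ideal.map_mono (map_le_cohomologyAnnihilatorOfDegree_four k h2 h hh)).trans
    (map_cohomologyAnnihilatorOfDegree_le_of_isLocalization M T 4)

end Summit.ResolutionOfSingularities.ResolutionOfSingularities.Theorems.HomologicalConductor.ArenaLower

end
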